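import Literature.MathematicalPhysics.QuantumFieldTheory.Balaban1983to89.Node00.Record12NumericsFamilyDict

/-!
# NODE 00 (YM-PLAN Track A) — COLOUR ∕ CARRIER TIE FACES OF THE DICTIONARY OF RECORD (NIT-529a, dag-ref-H g31; FLAG №14 follow-up)

After the RECORD-NONABELIAN RE-KEY (director-ym №256 (2), edition p694656, commit a333aab9a3bd) the dictionary of record
`stage3OfRecord₁₂` carries the colour number `N₅ := 2` AND the coefficient C⋆-algebra `𝔸 := Matrix (Fin 2) (Fin 2) ℂ` as two
INDEPENDENT fields of `Stage3Params`: nothing in the structure ties `𝔸 : Type` to `N₅ : ℕ` (referee dag-ref-H g31's planted-defect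
control #4: a copy re-keyed to `Matrix (Fin 3) (Fin 3) ℂ` with `N₅ := 2` left elaborates).  This zero-dependant leaf makes the tie
KERNEL-CHECKED by `rfl`, for the record and for every family dictionary `stage3OfFamily F` (which inherits both fields through
`Record12NumericsFamilyDict`), so that any future edition of the record that lets the two drift apart fails HERE and not silently.

* `stage3OfRecord₁₂_N₅ : stage3OfRecord₁₂.N₅ = 2` and `stage3OfRecord₁₂_𝔸 : stage3OfRecord₁₂.𝔸 = Matrix (Fin stage3OfRecord₁₂.N₅) (Fin stage3OfRecord₁₂.N₅) ℂ`;
* `stage3OfFamily_N₅ F`, `stage3OfFamily_𝔸 F` — the same two faces for the family dictionary;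
* `stage3OfFamily_𝔸_eq_record F : (stage3OfFamily F).𝔸 = stage3OfRecord₁₂.𝔸` — the family never re-keys the carrier.

HONEST SCOPE.  Bookkeeping by `rfl` on the tree's own definitions; one finite `𝕋⁴` programme at fixed `ε`, Bałaban as printed
([Balaban1985RegularSpaces] p.77: gauge group `SU(N)`/`U(N)`, fields in `M_N(ℂ)`; [Balaban1987RG1] (0.1) p.251); nothing continuum,
nothing on `ℝ⁴`, no OS axiom, no mass gap, no Clay statement; no key inhabitant is claimed (K0⁷ `Record13SepCoPHInhabited` OPEN);
COUNT-NEUTRAL.  A NEW leaf, not an edition of `Node00/Record12Numerics.lean`: it costs no reverse-cone rebuild.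
-/

namespace Literature.MathematicalPhysics.QuantumFieldTheory.Balaban1983to89.Node00

open T4Continuum

/-- The colour number of the dictionary of record is `N₅ = 2` (`rfl`). [cite: Balaban1985RegularSpaces, p.77 (bookkeeping)] -/
theorem stage3OfRecord₁₂_N₅ : stage3OfRecord₁₂.N₅ = 2 := rfl

/-- TIE FACE (NIT-529a): the coefficient C⋆-algebra of the dictionary of record is the full matrix algebra `M_{N₅}(ℂ)` of ITS OWN colour
number — `𝔸 = Matrix (Fin N₅) (Fin N₅) ℂ` by `rfl`; an edition that re-keys one field without the other breaks this face.
[cite: Balaban1985RegularSpaces, p.77 (bookkeeping); Balaban1987RG1, (0.1) p.251 (bookkeeping)] -/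
theorem stage3OfRecord₁₂_𝔸 :
    stage3OfRecord₁₂.𝔸 = Matrix (Fin stage3OfRecord₁₂.N₅) (Fin stage3OfRecord₁₂.N₅) ℂ := rfl

variable (F : T4Family)

/-- The family dictionary inherits the record's colour number, `N₅ = 2` (`rfl`). [cite: Balaban1987RG1, (0.1) p.251 (bookkeeping)] -/
theorem stage3OfFamily_N₅ : (stage3OfFamily F).N₅ = 2 := rfl

/-- TIE FACE for the family dictionary: `(stage3OfFamily F).𝔸 = Matrix (Fin N₅) (Fin N₅) ℂ` at its own `N₅` (`rfl`).
[cite: Balaban1985RegularSpaces, p.77 (bookkeeping); Balaban1987RG1, (0.1) p.251 (bookkeeping)] -/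
theorem stage3OfFamily_𝔸 :
    (stage3OfFamily F).𝔸 = Matrix (Fin (stage3OfFamily F).N₅) (Fin (stage3OfFamily F).N₅) ℂ := rfl

/-- The family dictionary never re-keys the carrier: `(stage3OfFamily F).𝔸 = stage3OfRecord₁₂.𝔸` (`rfl`).
[cite: Balaban1987RG1, (0.1) p.251 (bookkeeping)] -/
theorem stage3OfFamily_𝔸_eq_record : (stage3OfFamily F).𝔸 = stage3OfRecord₁₂.𝔸 := rfl

end Literature.MathematicalPhysics.QuantumFieldTheory.Balaban1983to89.Node00
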